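import Mathlib

/-!
# Product parabola lifts at the exponent `3/2`: the spectral signature
(crux `LevelOneGL2Designs`, stmt-MatrixMultiplication-14080, wall stub `stub_tangencySets`;
wall-breaker axis k8/12 "parabola lifts over finite fields")

Every construction on this axis that survives reduction to a prime field is a **product parabola
lift**: parameter set `Y × A ⊆ 𝔽_p²` (points `(y² + a, y)`, or `(y, y² + a)`, with the tangent of the
translated parabola), which is a tangency set iff `a' - a = (y - y')²` has only the diagonal solutions,
i.e. `(A - A) ∩ {(y - y')² : y ≠ y' ∈ Y} = ∅` (integer/number-ring box lifts after reduction,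
Paley pencils `Y = 𝔽_p`, the exact data of the k8 seats for `p ≤ 47`).  The stub at exponent `3/2`
asks for `|A|·|Y| ≥ c·p^{3/2}`.  This file records what such a pair must look like spectrally
(`ψ = ZMod.stdAddChar`, all statements over `ZMod p`, `p` prime):

* `card_mul_card_sq_le` : if `‖Σ_{y,y'∈Y} ψ(ξ(y-y')²)‖ ≤ B` for all `ξ ≠ 0` then
  `|A|·|Y|² ≤ p·|Y| + B·(p - |A|)` — count the `|A||Y|` solutions by orthogonality,
  `p|A||Y| = Σ_ξ |Â(ξ)|² S_Y(ξ)`, isolate `ξ = 0` and use Parseval;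
* `norm_quadAutocorr_le` : `p` odd, `ξ ≠ 0 ⇒ ‖Σ_{y,y'∈Y} ψ(ξ(y-y')²)‖ ≤ √p·|Y|` for EVERY `Y`
  (bilinear Gauss sum: `ψ(ξ(y-y')²) = u_y u_{y'} ψ(-2ξyy')`, Plancherel, Cauchy–Schwarz);
* `card_mul_card_le` : hence `|A|·|Y| ≤ p + √p·(p - |A|) ≤ p^{3/2} + p` for product lifts
  (the ceiling of `…TangencyUpperBound` re-proved spectrally in the product case);
* `exists_large_quadAutocorr` : conversely a product lift with `|A|·|Y| ≥ c·p^{3/2}` flags has a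
  frequency `ξ ≠ 0` with `‖Σ_{y,y'∈Y} ψ(ξ(y-y')²)‖ ≥ (c√p - 1)·|Y|`, i.e. the quadratic
  autocorrelation of `Y` is within the factor `c - p^{-1/2}` of its universal maximum.

Reading.  Random or generic `Y` with `|Y| ≪ p` have all non-trivial quadratic autocorrelations of
size `O(|Y| + |Y|²/√p)` up to logarithms, so they carry no product lift beyond `p^{1+o(1)}` flags;
the sets that pass the test are the quadratically structured ones — the whole field (Paley pencil,
`A` a Paley coclique, square-root barrier), intervals and Bohr sets at the frequencies `ξ = 1/(4k)`
(integer and number-ring lifts, `A` then governed by Furstenberg–Sárközy) — which is exactly where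
every known mechanism for the `A`-side stops at `o(p^{3/2})`.  The test is necessary, not
sufficient, and it is weak for small `c`; the stub at exponent `3/2` stays open.

References: Z. Hunter, C. Pohoata, J. Verstraëte, S. Zhang, arXiv:2601.19879 (2026), §2 and
Conj. 10.2 [bib: HunterPohoataVerstraeteZhang2026]; C. Pohoata, arXiv:2607.20422 (2026), §2
[bib: Pohoata2026SharpExponentMinimalDistance] (the product/parabola-lift format).  The Fourier
argument is the standard one (e.g. the proof of `IM(2,q) ≤ q^{3/2} + q`).
-/

-- justification: the summit/problem path `MatrixMultiplication.MatrixMultiplication` is fixed by the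
-- tree layout (D-0017), so the namespace necessarily repeats a component.
set_option linter.dupNamespace false

noncomputable section

open Finset

namespace Summit.MatrixMultiplication.MatrixMultiplication.Theorems.LevelOneGL2Designs.ProductLiftSpectral

variable {p : ℕ} [hp : Fact p.Prime]

/-- Orthogonality of the additive characters of `ZMod p`: `Σ_ξ ψ(ξ z) = p·[z = 0]`. [elementary] -/
theorem sum_psi_mul (z : ZMod p) : ∑ ξ : ZMod p, ZMod.stdAddChar (ξ * z) = if z = 0 then (p : ℂ) else 0 := by
  haveI : NeZero p := ⟨hp.out.ne_zero⟩
  rw [AddChar.sum_mulShift z (ZMod.isPrimitive_stdAddChar p), ZMod.card, Nat.cast_ite, Nat.cast_zero]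

/-- `ψ` is unimodular. [elementary] -/
theorem norm_psi (x : ZMod p) : ‖ZMod.stdAddChar x‖ = 1 := by
  haveI : NeZero p := ⟨hp.out.ne_zero⟩
  rw [ZMod.stdAddChar_apply, Circle.norm_coe]

/-- Complex conjugation inverts `ψ`: `conj ψ(x) = ψ(-x)`. [elementary] -/
theorem conj_psi (x : ZMod p) : starRingEnd ℂ (ZMod.stdAddChar x) = ZMod.stdAddChar (-x) := by
  have hR : 0 < ringChar (ZMod p) := by rw [ZMod.ringChar_zmod_n]; exact hp.out.pos
  rw [AddChar.starComp_apply hR, AddChar.inv_apply]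

/-- `z · conj z = ‖z‖²` in the form used below. -/
theorem mul_conj_eq_norm_sq (z : ℂ) : z * starRingEnd ℂ z = ((‖z‖ ^ 2 : ℝ) : ℂ) := by
  rw [Complex.mul_conj, Complex.normSq_eq_norm_sq]

/-- **Spectral inequality for product parabola lifts.**  Let `A, Y ⊆ 𝔽_p` be such that the product
parameter set `Y × A` is parabola-free, i.e. `a' - a = (y - y')²` with `a, a' ∈ A`, `y, y' ∈ Y` forces
`y = y'` (equivalently `(A - A) ∩ {(y-y')² : y ≠ y' ∈ Y} = ∅`; these are exactly the product
tangency sets `{(y² + a, y)}` of the parabola-lift files).  If every non-trivial quadratic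
autocorrelation of `Y` is bounded, `‖Σ_{y,y' ∈ Y} ψ(ξ (y-y')²)‖ ≤ B` for all `ξ ≠ 0`, then

  `|A| · |Y|² ≤ p · |Y| + B · (p - |A|)`.

Proof: count the solutions of `a' - a = (y-y')²` (exactly the `|A|·|Y|` diagonal ones) by
orthogonality, `p|A||Y| = Σ_ξ Â(ξ) conj Â(ξ) S_Y(ξ)`, isolate `ξ = 0` (`|A|²|Y|²`) and bound the rest
by `B · Σ_{ξ≠0} |Â(ξ)|² = B (p|A| - |A|²)` (Parseval). [elementary] -/
theorem card_mul_card_sq_le {p : ℕ} [Fact p.Prime] (A Y : Finset (ZMod p)) {B : ℝ} (hB0 : 0 ≤ B)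
    (hB : ∀ ξ : ZMod p, ξ ≠ 0 → ‖∑ y ∈ Y, ∑ y' ∈ Y, ZMod.stdAddChar (ξ * (y - y') ^ 2)‖ ≤ B)
    (hfree : ∀ a ∈ A, ∀ a' ∈ A, ∀ y ∈ Y, ∀ y' ∈ Y, a' - a = (y - y') ^ 2 → y = y') :
    (A.card : ℝ) * Y.card ^ 2 ≤ p * Y.card + B * (p - A.card) := by
  classical
  set F : ZMod p → ℂ := fun ξ => ∑ a ∈ A, ZMod.stdAddChar (ξ * a) with hF
  set G : ZMod p → ℂ := fun ξ => ∑ a ∈ A, ZMod.stdAddChar (-(ξ * a)) with hG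
  set S : ZMod p → ℂ := fun ξ => ∑ y ∈ Y, ∑ y' ∈ Y, ZMod.stdAddChar (-(ξ * (y - y') ^ 2)) with hS
  -- `G = conj F`
  have hGconj : ∀ ξ, G ξ = starRingEnd ℂ (F ξ) := by
    intro ξ
    simp only [hF, hG, map_sum, conj_psi]
  have hFG : ∀ ξ, F ξ * G ξ = ((‖F ξ‖ ^ 2 : ℝ) : ℂ) := fun ξ => by
    rw [hGconj, mul_conj_eq_norm_sq]
  have hnormG : ∀ ξ, ‖G ξ‖ = ‖F ξ‖ := fun ξ => by rw [hGconj, Complex.norm_conj]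
  -- values at `ξ = 0`
  have hF0 : F 0 = A.card := by
    simp only [hF, zero_mul, AddChar.map_zero_eq_one, sum_const, nsmul_eq_mul, mul_one]
  have hG0 : G 0 = A.card := by
    simp only [hG, zero_mul, neg_zero, AddChar.map_zero_eq_one, sum_const, nsmul_eq_mul, mul_one]
  have hS0 : S 0 = Y.card * Y.card := by
    simp only [hS, zero_mul, neg_zero, AddChar.map_zero_eq_one, sum_const, nsmul_eq_mul, mul_one]
  -- Parseval: `Σ_ξ F G = p |A|`
  have hpars : ∑ ξ, F ξ * G ξ = (p : ℂ) * A.card := by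
    calc ∑ ξ, F ξ * G ξ = ∑ ξ, ∑ a' ∈ A, ∑ a ∈ A, ZMod.stdAddChar (ξ * (a' - a)) := by
          refine Finset.sum_congr rfl fun ξ _ => ?_
          simp only [hF, hG, Finset.sum_mul_sum]
          refine Finset.sum_congr rfl fun a' _ => Finset.sum_congr rfl fun a _ => ?_
          rw [← AddChar.map_add_eq_mul]; congr 1; ring
      _ = ∑ a' ∈ A, ∑ a ∈ A, ∑ ξ, ZMod.stdAddChar (ξ * (a' - a)) := by
          rw [Finset.sum_comm]
          exact Finset.sum_congr rfl fun a' _ => Finset.sum_comm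
      _ = ∑ a' ∈ A, ∑ a ∈ A, if a' - a = 0 then (p : ℂ) else 0 := by simp only [sum_psi_mul]
      _ = ∑ a' ∈ A, (p : ℂ) := by
          refine Finset.sum_congr rfl fun a' ha' => ?_
          simp only [sub_eq_zero]
          rw [Finset.sum_ite_eq, if_pos ha']
      _ = (p : ℂ) * A.card := by rw [Finset.sum_const, nsmul_eq_mul, mul_comm]
  have hparsR : ∑ ξ, ‖F ξ‖ ^ 2 = (p : ℝ) * A.card := by
    have h : ((∑ ξ, ‖F ξ‖ ^ 2 : ℝ) : ℂ) = (p : ℂ) * A.card := by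
      rw [← hpars, Complex.ofReal_sum]
      exact Finset.sum_congr rfl fun ξ _ => (hFG ξ).symm
    exact_mod_cast h
  -- the inner count, using parabola-freeness
  have hinner : ∀ a' ∈ A, ∀ a ∈ A,
      (∑ y ∈ Y, ∑ y' ∈ Y, if a' - a - (y - y') ^ 2 = 0 then (p : ℂ) else 0) =
        if a' = a then (p : ℂ) * Y.card else 0 := by
    intro a' ha' a ha
    split_ifs with h
    · subst h
      have key : ∀ y y' : ZMod p, (a' - a' - (y - y') ^ 2 = 0 ↔ y = y') := by
        intro y y'
        rw [sub_self, zero_sub, neg_eq_zero, pow_eq_zero_iff two_ne_zero, sub_eq_zero]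
      calc (∑ y ∈ Y, ∑ y' ∈ Y, if a' - a' - (y - y') ^ 2 = 0 then (p : ℂ) else 0)
          = ∑ y ∈ Y, ∑ y' ∈ Y, if y = y' then (p : ℂ) else 0 := by
            refine sum_congr rfl fun y _ => sum_congr rfl fun y' _ => by simp only [key y y']
        _ = ∑ y ∈ Y, (p : ℂ) := by
            refine sum_congr rfl fun y hy => ?_
            rw [Finset.sum_ite_eq, if_pos hy]
        _ = (p : ℂ) * Y.card := by rw [sum_const, nsmul_eq_mul, mul_comm]
    · refine Finset.sum_eq_zero fun y hy => Finset.sum_eq_zero fun y' hy' => ?_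
      rw [if_neg]
      intro h0
      have h1 : a' - a = (y - y') ^ 2 := sub_eq_zero.mp h0
      have hyy : y = y' := hfree a ha a' ha' y hy y' hy' h1
      subst hyy
      apply h
      rw [sub_self, zero_pow two_ne_zero] at h1
      exact sub_eq_zero.mp h1
  -- the count: `Σ_ξ F G S = p |A| |Y|`
  have hcount : ∑ ξ, F ξ * G ξ * S ξ = (p : ℂ) * A.card * Y.card := by
    calc ∑ ξ, F ξ * G ξ * S ξ
        = ∑ ξ, ∑ a' ∈ A, ∑ a ∈ A, ∑ y ∈ Y, ∑ y' ∈ Y, ZMod.stdAddChar (ξ * (a' - a - (y - y') ^ 2)) := by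
          refine Finset.sum_congr rfl fun ξ _ => ?_
          simp only [hF, hG, hS]
          rw [Finset.sum_mul_sum, Finset.sum_mul]
          refine Finset.sum_congr rfl fun a' _ => ?_
          rw [Finset.sum_mul]
          refine Finset.sum_congr rfl fun a _ => ?_
          rw [Finset.mul_sum]
          refine Finset.sum_congr rfl fun y _ => ?_
          rw [Finset.mul_sum]
          refine Finset.sum_congr rfl fun y' _ => ?_
          rw [← AddChar.map_add_eq_mul, ← AddChar.map_add_eq_mul]; congr 1; ring
      _ = ∑ a' ∈ A, ∑ a ∈ A, ∑ y ∈ Y, ∑ y' ∈ Y, ∑ ξ, ZMod.stdAddChar (ξ * (a' - a - (y - y') ^ 2)) := by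
          rw [Finset.sum_comm]
          refine Finset.sum_congr rfl fun a' _ => ?_
          rw [Finset.sum_comm]
          refine Finset.sum_congr rfl fun a _ => ?_
          rw [Finset.sum_comm]
          refine Finset.sum_congr rfl fun y _ => ?_
          rw [Finset.sum_comm]
      _ = ∑ a' ∈ A, ∑ a ∈ A, ∑ y ∈ Y, ∑ y' ∈ Y,
            if a' - a - (y - y') ^ 2 = 0 then (p : ℂ) else 0 := by simp only [sum_psi_mul]
      _ = ∑ a' ∈ A, ∑ a ∈ A, if a' = a then (p : ℂ) * Y.card else 0 := by
          refine Finset.sum_congr rfl fun a' ha' => Finset.sum_congr rfl fun a ha => ?_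
          exact hinner a' ha' a ha
      _ = ∑ a' ∈ A, (p : ℂ) * Y.card := by
          refine Finset.sum_congr rfl fun a' ha' => ?_
          rw [Finset.sum_ite_eq, if_pos ha']
      _ = (p : ℂ) * A.card * Y.card := by rw [Finset.sum_const, nsmul_eq_mul]; ring
  -- isolate `ξ = 0`
  set E : Finset (ZMod p) := Finset.univ.erase 0 with hE
  have hsplit : ∑ ξ ∈ E, F ξ * G ξ * S ξ =
      (p : ℂ) * A.card * Y.card - (A.card : ℂ) ^ 2 * (Y.card : ℂ) ^ 2 := by
    have h := Finset.add_sum_erase Finset.univ (fun ξ => F ξ * G ξ * S ξ) (Finset.mem_univ 0)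
    rw [hcount, hF0, hG0, hS0] at h
    rw [hE, ← h]
    ring
  have hsplitR : ∑ ξ ∈ E, ‖F ξ‖ ^ 2 = (p : ℝ) * A.card - (A.card : ℝ) ^ 2 := by
    have h := Finset.add_sum_erase Finset.univ (fun ξ => ‖F ξ‖ ^ 2) (Finset.mem_univ 0)
    rw [hparsR, hF0, Complex.norm_natCast] at h
    rw [hE, ← h]
    ring
  -- bound the off-zero part
  have hbound : ‖∑ ξ ∈ E, F ξ * G ξ * S ξ‖ ≤ B * ((p : ℝ) * A.card - (A.card : ℝ) ^ 2) := by
    rw [← hsplitR, Finset.mul_sum]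
    refine (norm_sum_le _ _).trans (Finset.sum_le_sum fun ξ hξ => ?_)
    have hξ0 : ξ ≠ 0 := Finset.ne_of_mem_erase hξ
    have hSle : ‖S ξ‖ ≤ B := by
      have := hB (-ξ) (neg_ne_zero.mpr hξ0)
      simpa only [hS, neg_mul] using this
    rw [norm_mul, norm_mul, hnormG, ← sq]
    calc ‖F ξ‖ ^ 2 * ‖S ξ‖ ≤ ‖F ξ‖ ^ 2 * B :=
          mul_le_mul_of_nonneg_left hSle (sq_nonneg _)
      _ = B * ‖F ξ‖ ^ 2 := mul_comm _ _
  -- assemble (all quantities are real)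
  have hmain : (A.card : ℝ) ^ 2 * (Y.card : ℝ) ^ 2 - (p : ℝ) * A.card * Y.card ≤
      B * ((p : ℝ) * A.card - (A.card : ℝ) ^ 2) := by
    refine le_trans ?_ hbound
    rw [hsplit]
    have : ((p : ℂ) * A.card * Y.card - (A.card : ℂ) ^ 2 * (Y.card : ℂ) ^ 2) =
        (((p : ℝ) * A.card * Y.card - (A.card : ℝ) ^ 2 * (Y.card : ℝ) ^ 2 : ℝ) : ℂ) := by
      push_cast; ring
    rw [this, Complex.norm_real, Real.norm_eq_abs]
    have := neg_abs_le ((p : ℝ) * A.card * Y.card - (A.card : ℝ) ^ 2 * (Y.card : ℝ) ^ 2)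
    linarith
  -- divide by `|A|`
  rcases Nat.eq_zero_or_pos A.card with hA | hA
  · rw [hA]
    simp only [Nat.cast_zero, zero_mul, sub_zero]
    positivity
  · have hAR : (0 : ℝ) < A.card := by exact_mod_cast hA
    have h2 : (A.card : ℝ) * ((A.card : ℝ) * Y.card ^ 2 - (p * Y.card + B * (p - A.card))) ≤ 0 := by
      nlinarith
    nlinarith

/-- **Quadratic autocorrelations never exceed `√p · |Y|`.**  For `p` odd, `ξ ≠ 0` and any
`Y ⊆ 𝔽_p`, `‖Σ_{y,y'∈Y} ψ(ξ(y-y')²)‖ ≤ √p · |Y|`: writing `ψ(ξ(y-y')²) = u_y u_{y'} ψ(-2ξyy')`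
(`u_y = ψ(ξy²)`), the double sum is `Σ_{y∈Y} u_y w_y` with `w = ` a dilated Fourier transform of
`u·1_Y`, and `Σ_y |w_y|² = p|Y|` (Plancherel), so Cauchy–Schwarz gives the bound.  Equality (up to
lower order) holds for `Y = 𝔽_p` (a complete Gauss sum). [elementary] -/
theorem norm_quadAutocorr_le (hp2 : p ≠ 2) (Y : Finset (ZMod p)) {ξ : ZMod p} (hξ : ξ ≠ 0) :
    ‖∑ y ∈ Y, ∑ y' ∈ Y, ZMod.stdAddChar (ξ * (y - y') ^ 2)‖ ≤ Real.sqrt p * Y.card := by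
  classical
  set u : ZMod p → ℂ := fun y => ZMod.stdAddChar (ξ * y ^ 2) with hu
  set w : ZMod p → ℂ := fun y => ∑ y' ∈ Y, u y' * ZMod.stdAddChar (-(2 * ξ * y * y')) with hw
  have hun : ∀ y, ‖u y‖ = 1 := fun y => norm_psi _
  have h2 : (2 : ZMod p) ≠ 0 := by
    intro h
    have h' : ((2 : ℕ) : ZMod p) = 0 := by exact_mod_cast h
    rw [CharP.cast_eq_zero_iff (ZMod p) p 2] at h'
    have h1 := Nat.le_of_dvd two_pos h'
    have h2 := hp.out.two_le
    omega
  have h2ξ : (2 : ZMod p) * ξ ≠ 0 := mul_ne_zero h2 hξ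
  -- factorisation of the double sum
  have hfac : ∑ y ∈ Y, ∑ y' ∈ Y, ZMod.stdAddChar (ξ * (y - y') ^ 2) = ∑ y ∈ Y, u y * w y := by
    refine Finset.sum_congr rfl fun y _ => ?_
    rw [hw]
    simp only
    rw [Finset.mul_sum]
    refine Finset.sum_congr rfl fun y' _ => ?_
    rw [hu]
    simp only
    rw [← mul_assoc, ← AddChar.map_add_eq_mul, ← AddChar.map_add_eq_mul]
    congr 1
    ring
  -- Plancherel for `w`
  have hplan : ∑ y, ‖w y‖ ^ 2 = (p : ℝ) * Y.card := by
    have h : ((∑ y, ‖w y‖ ^ 2 : ℝ) : ℂ) = (p : ℂ) * Y.card := by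
      rw [Complex.ofReal_sum]
      calc ∑ y, ((‖w y‖ ^ 2 : ℝ) : ℂ)
          = ∑ y, ∑ y' ∈ Y, ∑ y'' ∈ Y,
              (u y' * starRingEnd ℂ (u y'')) * ZMod.stdAddChar (y * (2 * ξ * (y'' - y'))) := by
            refine sum_congr rfl fun y _ => ?_
            rw [← mul_conj_eq_norm_sq, hw]
            simp only [map_sum, map_mul, conj_psi, neg_neg]
            rw [Finset.sum_mul_sum]
            refine sum_congr rfl fun y' _ => sum_congr rfl fun y'' _ => ?_
            rw [mul_mul_mul_comm, ← AddChar.map_add_eq_mul]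
            congr 2
            ring
        _ = ∑ y' ∈ Y, ∑ y'' ∈ Y,
              (u y' * starRingEnd ℂ (u y'')) * ∑ y, ZMod.stdAddChar (y * (2 * ξ * (y'' - y'))) := by
            rw [Finset.sum_comm]
            refine sum_congr rfl fun y' _ => ?_
            rw [Finset.sum_comm]
            refine sum_congr rfl fun y'' _ => ?_
            rw [Finset.mul_sum]
        _ = ∑ y' ∈ Y, ∑ y'' ∈ Y, if y' = y'' then (p : ℂ) else 0 := by
            refine sum_congr rfl fun y' _ => sum_congr rfl fun y'' _ => ?_
            rw [sum_psi_mul]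
            by_cases hy : y' = y''
            · subst hy
              rw [if_pos (by rw [sub_self, mul_zero]), if_pos rfl, mul_conj_eq_norm_sq, hun]
              push_cast
              ring
            · have hne : 2 * ξ * (y'' - y') ≠ 0 := mul_ne_zero h2ξ (sub_ne_zero.mpr (Ne.symm hy))
              rw [if_neg hne, if_neg hy, mul_zero]
        _ = ∑ y' ∈ Y, (p : ℂ) := by
            refine sum_congr rfl fun y' hy' => ?_
            rw [Finset.sum_ite_eq, if_pos hy']
        _ = (p : ℂ) * Y.card := by rw [sum_const, nsmul_eq_mul, mul_comm]
    exact_mod_cast h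
  -- Cauchy–Schwarz
  have hT0 : 0 ≤ ∑ y ∈ Y, ‖w y‖ := Finset.sum_nonneg fun _ _ => norm_nonneg _
  have hCS : (∑ y ∈ Y, ‖w y‖) ^ 2 ≤ (p : ℝ) * (Y.card : ℝ) ^ 2 := by
    have h1 := Finset.sum_mul_sq_le_sq_mul_sq Y (fun _ => (1 : ℝ)) (fun y => ‖w y‖)
    simp only [one_mul, one_pow, sum_const, nsmul_eq_mul, mul_one] at h1
    have h2 : ∑ y ∈ Y, ‖w y‖ ^ 2 ≤ ∑ y, ‖w y‖ ^ 2 :=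
      Finset.sum_le_sum_of_subset_of_nonneg (Finset.subset_univ Y) fun _ _ _ => sq_nonneg _
    rw [hplan] at h2
    nlinarith [h1, h2, Nat.cast_nonneg (α := ℝ) Y.card]
  calc ‖∑ y ∈ Y, ∑ y' ∈ Y, ZMod.stdAddChar (ξ * (y - y') ^ 2)‖ = ‖∑ y ∈ Y, u y * w y‖ := by rw [hfac]
    _ ≤ ∑ y ∈ Y, ‖w y‖ := norm_sum_le_of_le _ fun y _ => by rw [norm_mul, hun, one_mul]
    _ = |∑ y ∈ Y, ‖w y‖| := (abs_of_nonneg hT0).symm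
    _ ≤ Real.sqrt ((p : ℝ) * (Y.card : ℝ) ^ 2) := Real.abs_le_sqrt hCS
    _ = Real.sqrt p * Y.card := by
        rw [Real.sqrt_mul (Nat.cast_nonneg p), Real.sqrt_sq (Nat.cast_nonneg _)]

/-- **The ceiling `p^{3/2} + p` for product lifts, spectrally.**  For `p` odd and `Y × A`
parabola-free: `|A|·|Y| ≤ p + √p · (p - |A|)` (in particular `≤ p^{3/2} + p`). [elementary] -/
theorem card_mul_card_le (hp2 : p ≠ 2) (A Y : Finset (ZMod p))
    (hfree : ∀ a ∈ A, ∀ a' ∈ A, ∀ y ∈ Y, ∀ y' ∈ Y, a' - a = (y - y') ^ 2 → y = y') :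
    (A.card : ℝ) * Y.card ≤ p + Real.sqrt p * (p - A.card) := by
  have hAp : (A.card : ℝ) ≤ p := by
    have := Finset.card_le_univ A
    rw [ZMod.card] at this
    exact_mod_cast this
  have hmain := card_mul_card_sq_le A Y (by positivity)
    (fun ξ hξ => norm_quadAutocorr_le hp2 Y hξ) hfree
  rcases Nat.eq_zero_or_pos Y.card with hY | hY
  · rw [hY]
    simp only [Nat.cast_zero, mul_zero]
    have : 0 ≤ Real.sqrt p * (p - A.card) := mul_nonneg (Real.sqrt_nonneg _) (by linarith)
    positivity
  · have hYR : (0 : ℝ) < Y.card := by exact_mod_cast hY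
    have h2 : (Y.card : ℝ) * ((A.card : ℝ) * Y.card - (p + Real.sqrt p * (p - A.card))) ≤ 0 := by
      nlinarith
    nlinarith

/-- **Spectral signature of a product lift at the exponent `3/2`.**  If `Y × A` is parabola-free
with `|A|·|Y| ≥ c · p^{3/2}` (`Y ≠ ∅`), then at some frequency `ξ ≠ 0` the quadratic
autocorrelation of `Y` is at least `(c√p - 1)·|Y|` — within the factor `c - p^{-1/2}` of the
universal maximum `√p·|Y|` of `norm_quadAutocorr_le`.  (Random `Y` of size `≪ p` have all such
autocorrelations `O(|Y| + |Y|²/√p)` up to logarithms, so they support no product lift beyond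
`p^{1+o(1)}` flags; the sets that qualify — intervals, Bohr sets, the whole field — are the ones
whose `A`-side is governed by Furstenberg–Sárközy resp. Paley cocliques.) [elementary] -/
theorem exists_large_quadAutocorr (A Y : Finset (ZMod p)) (hY : Y.Nonempty)
    (hfree : ∀ a ∈ A, ∀ a' ∈ A, ∀ y ∈ Y, ∀ y' ∈ Y, a' - a = (y - y') ^ 2 → y = y') {c : ℝ}
    (hc : c * (p : ℝ) ^ (3 / 2 : ℝ) ≤ (A.card : ℝ) * Y.card) :
    ∃ ξ : ZMod p, ξ ≠ 0 ∧
      (c * Real.sqrt p - 1) * Y.card ≤ ‖∑ y ∈ Y, ∑ y' ∈ Y, ZMod.stdAddChar (ξ * (y - y') ^ 2)‖ := by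
  haveI : Fact (1 < p) := ⟨hp.out.one_lt⟩
  have hYR : (0 : ℝ) < Y.card := by exact_mod_cast hY.card_pos
  have hp0 : (0 : ℝ) < p := by exact_mod_cast hp.out.pos
  have hp32 : (p : ℝ) ^ (3 / 2 : ℝ) = p * Real.sqrt p := by
    rw [show (3 / 2 : ℝ) = 1 + 1 / 2 by norm_num, Real.rpow_add hp0, Real.rpow_one,
      Real.sqrt_eq_rpow]
  by_contra h
  push Not at h
  set B : ℝ := (c * Real.sqrt p - 1) * Y.card with hB
  by_cases hBpos : B ≤ 0
  · have := h 1 one_ne_zero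
    linarith [norm_nonneg (∑ y ∈ Y, ∑ y' ∈ Y, ZMod.stdAddChar (1 * (y - y') ^ 2))]
  rw [not_le] at hBpos
  have hmain := card_mul_card_sq_le A Y hBpos.le (fun ξ hξ => (h ξ hξ).le) hfree
  -- `hmain : |A|·|Y|² ≤ p|Y| + B (p - |A|)` with `B (p - |A|) = (c√p - 1)|Y| p - B |A|`
  have hcp : c * p * Real.sqrt p ≤ (A.card : ℝ) * Y.card := by
    rw [hp32, ← mul_assoc] at hc
    exact hc
  have hkey : B * (A.card : ℝ) ≤ 0 := by nlinarith
  have hA0 : (A.card : ℝ) ≤ 0 := by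
    by_contra hA
    rw [not_le] at hA
    nlinarith
  have hA0' : (A.card : ℝ) = 0 := le_antisymm hA0 (Nat.cast_nonneg _)
  rw [hA0', zero_mul] at hcp
  have hc0 : c ≤ 0 := by
    by_contra hc'
    rw [not_le] at hc'
    have : 0 < c * p * Real.sqrt p := by
      have := Real.sqrt_pos.mpr hp0
      positivity
    linarith
  have : B ≤ 0 := by
    rw [hB]
    have : c * Real.sqrt p ≤ 0 := mul_nonpos_of_nonpos_of_nonneg hc0 (Real.sqrt_nonneg _)
    nlinarith
  linarith

end Summit.MatrixMultiplication.MatrixMultiplication.Theorems.LevelOneGL2Designs.ProductLiftSpectral
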